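import Summits.CriticalPhenomena.PercolationContinuityZ3.Theorems.PercNearOneGluingNoHeavyLowerTailQuantitativeBHKMajorant
import Literature.Probability.Percolation.TwoClusterConditionalAssociationProofs
import HarnessLib

/-!
# Quantitative two-cluster repulsion: an explicit floor for BHK's Theorem 1.4 / eq. (2)

Support file (`--supports stmt-CriticalPhenomena-4575`), prover seat `prim-rate-mine-2` (lane prim-rate, constants-miner (c), BENCH row
M2-R11, «deletion» member of the attachment-floor family; `run/shared/lean/prim/prim-rate/prim-rate-mine-2/CANDIDATES.md` §gen-2,
PROOFS.md §P8/P10).  No definitions, no named facts, no sorries; standard axioms.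

van den Berg–Häggström–Kahn (2006) prove that, conditionally on `{s ↮ t}`, increasing functions of the clusters `C_s` and `C_t` are
NEGATIVELY correlated (Thm 1.4; eq. (2) for connection events) — a sign statement.  Here the sign becomes an explicit floor:

* `twoCluster_negCov_ge_majorant_gap` (abstract, edge clusters): with `Ψ(W) = E[g(C_t) | C_s = W]` (BHK's display (10), computed in
  fresh variables off `W̄`) and ANY increasing `G̃` with `F·G̃ = F·(−Ψ)`,
  `−Cov_ν(F(C_s), g(C_t)) ≥ E_ν[F(C_s)]·E_ν[G̃(C_s) + Ψ(C_s)]`;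
* `twoCluster_repulsion_openConn_ge_deletion` (connection events): for `D = {s ↮ t}` and vertices `a, o`,
  `μ(D ∩ {s↔a})·∫_D (P_{C_s}(t↔o) − P_{C_s,a}(t↔o)) dμ ≤ μ(D ∩ {s↔a})μ(D ∩ {t↔o}) − μ(D)μ(D ∩ {s↔a} ∩ {t↔o})`,
  where `P_{C}(t↔o)` is the probability that `t ↔ o` in a fresh configuration with all pairs meeting `C` deleted and `P_{C,a}` also deletes
  the pairs at `a`: «the repulsion is at least ν(s↔a) times the expected drop of the residual t–o connectivity when a is deleted too».

In the CSH currency of this summit this floors the van den Berg–Häggström–Kahn term `R` of the level-0 margin `M0 = H + R` (paper Lemma 3.8),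
the term that carries the margin near `p = 1`.  Ingredients: BHK Thm 1.3 via the abstract majorant floor `QuantBHK.condCov_ge_majorant_gap`,
display (10) `BHK2006.sum_cond_cluster`, and the monotone coupling `BHK2006.condAvg_mono`.
[cite: VandenbergHaggstromKahn2005, Thm. 1.4 and eq. (2) (pp. 2, 7), display (10) (p. 7)]
-/

noncomputable section

namespace Summit.CriticalPhenomena.PercolationContinuityZ3.Theorems

open MeasureTheory Set Literature.Probability.LatticeModels Literature.Probability.Percolation
open scoped Classical
open Literature.Probability.Percolation.BHK2006 DecisionTree

namespace QuantBHK

universe v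

variable {V : Type v} [Fintype V]

/-! ### Display (10): conditioning on `C_s` turns a function of `C_t` into a function of `C_s` -/

/-- Integrals over `D = {s ↮ t}` as finite weighted sums (`BHK2006.weight`, `DecisionTree.ind`). [folklore] -/
theorem setIntegral_eq_sum_weight (w : Sym2 V → unitInterval) (D : Set (BondConfig V)) (h : BondConfig V → ℝ) :
    ∫ ω in D, h ω ∂(prodBernoulli w) = ∑ ω, weight (fun e => (w e : ℝ)) ω * (h ω * ind D ω) := by
  have hDm : MeasurableSet D := MeasurableSet.of_discrete
  rw [← integral_indicator hDm, integral_prodBernoulli_eq_sum]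
  refine Finset.sum_congr rfl fun ω _ => ?_
  by_cases hω : ω ∈ D
  · rw [Set.indicator_of_mem hω, ind_of_mem hω, mul_one]
  · rw [Set.indicator_of_notMem hω, ind_of_not_mem hω]; ring

/-- **Quantitative BHK Thm 1.4 from a monotone majorant (edge-cluster form).**  `D = {s ↮ t}`, `F` an increasing function of `C_s`,
`g` an increasing function of `C_t`, `Ψ(W) = Σ_η weight(η)·g(C_t(η ∖ W̄))` the conditional expectation of `g(C_t)` given `C_s = W`
(BHK's display (10); `W̄` = the pairs meeting `{s} ∪ V(W)`), and `G̃` ANY increasing function of edge sets with `F·G̃ = F·(−Ψ)`.  Then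
  `(∫_D F(C_s))·(∫_D G̃(C_s) + ∫_D g(C_t)) ≤ (∫_D F(C_s))(∫_D g(C_t)) − μ(D)·∫_D F(C_s) g(C_t)`,
i.e. `−Cov_ν(F(C_s), g(C_t)) ≥ E_ν[F(C_s)]·E_ν[G̃(C_s) + Ψ(C_s)]` for `ν = μ(·|D)`: the abstract majorant floor
(`condCov_ge_majorant_gap`, from BHK Thm 1.3) applied to `(F, −Ψ)` after display (10) (`BHK2006.sum_cond_cluster`).
[cite: VandenbergHaggstromKahn2005, Thm. 1.4 (p. 7), display (10) (p. 7)] -/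
theorem twoCluster_negCov_ge_majorant_gap (w : Sym2 V → unitInterval) (s t : V) (hst : s ≠ t)
    (F g Gt : Set (Sym2 V) → ℝ) (hF : Monotone F) (hGt : Monotone Gt)
    (hFG : ∀ W, F W * Gt W = F W *
      -(∑ η, weight (fun e => (w e : ℝ)) η *
        g (openEdgeCluster (η \ {e | ∃ v ∈ e, v = s ∨ ∃ e' ∈ W, v ∈ e'}) t))) :
    (∫ ω in {ω : BondConfig V | ¬ (openGraph ω).Reachable s t}, F (openEdgeCluster ω s) ∂(prodBernoulli w)) *
      ((∫ ω in {ω : BondConfig V | ¬ (openGraph ω).Reachable s t}, Gt (openEdgeCluster ω s) ∂(prodBernoulli w)) +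
        ∫ ω in {ω : BondConfig V | ¬ (openGraph ω).Reachable s t}, g (openEdgeCluster ω t) ∂(prodBernoulli w)) ≤
    (∫ ω in {ω : BondConfig V | ¬ (openGraph ω).Reachable s t}, F (openEdgeCluster ω s) ∂(prodBernoulli w)) *
        (∫ ω in {ω : BondConfig V | ¬ (openGraph ω).Reachable s t}, g (openEdgeCluster ω t) ∂(prodBernoulli w)) -
      (prodBernoulli w).real {ω : BondConfig V | ¬ (openGraph ω).Reachable s t} *
        ∫ ω in {ω : BondConfig V | ¬ (openGraph ω).Reachable s t},
          F (openEdgeCluster ω s) * g (openEdgeCluster ω t) ∂(prodBernoulli w) := by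
  set μ := prodBernoulli w with hμ
  set w' : Sym2 V → ℝ := fun e => (w e : ℝ) with hw'
  set D : Set (BondConfig V) := {ω : BondConfig V | ¬ (openGraph ω).Reachable s t} with hD
  have hDX : {ω : BondConfig V | ∀ x ∈ ({t} : Set V), ¬ (openGraph ω).Reachable s x} = D := by
    ext ω; simp [hD]
  set Ψ : Set (Sym2 V) → ℝ := fun W => ∑ η, weight w' η *
    g (openEdgeCluster (η \ {e | ∃ v ∈ e, v = s ∨ ∃ e' ∈ W, v ∈ e'}) t) with hΨ
  -- the abstract majorant floor for `(F, -Ψ, Gt)` given `{s ↮ {t}}`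
  have key := condCov_ge_majorant_gap w s ({t} : Set V) (by simpa using hst) F (fun W => -Ψ W) Gt hF hGt hFG
  rw [hDX] at key
  -- display (10): `∫_D Ψ(C_s) = ∫_D g(C_t)` and `∫_D F(C_s)Ψ(C_s) = ∫_D F(C_s) g(C_t)`
  have hm : ∑ ω, weight w' ω = 1 := by
    have h1 := integral_prodBernoulli_eq_sum w fun _ => (1 : ℝ)
    simp only [integral_const, probReal_univ, smul_eq_mul, mul_one] at h1
    exact h1.symm
  have hDiff : ∀ ω, ω ∈ D ↔ ¬ (openGraph ω).Reachable s t := fun ω => Iff.rfl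
  have h10a : ∫ ω in D, Ψ (openEdgeCluster ω s) ∂μ = ∫ ω in D, g (openEdgeCluster ω t) ∂μ := by
    rw [setIntegral_eq_sum_weight, setIntegral_eq_sum_weight]
    exact (sum_cond_cluster w' hm s t (fun _ K => g K) hDiff).symm
  have h10b : ∫ ω in D, F (openEdgeCluster ω s) * Ψ (openEdgeCluster ω s) ∂μ =
      ∫ ω in D, F (openEdgeCluster ω s) * g (openEdgeCluster ω t) ∂μ := by
    rw [setIntegral_eq_sum_weight, setIntegral_eq_sum_weight,
      show (∑ ω, weight w' ω * (F (openEdgeCluster ω s) * g (openEdgeCluster ω t) * ind D ω)) = _ from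
        sum_cond_cluster w' hm s t (fun C K => F C * g K) hDiff]
    refine Finset.sum_congr rfl fun ω _ => ?_
    simp only [hΨ, Finset.mul_sum, Finset.sum_mul]
    refine Finset.sum_congr rfl fun η _ => ?_
    ring
  have hneg1 : ∫ ω in D, (fun W => -Ψ W) (openEdgeCluster ω s) ∂μ = -∫ ω in D, g (openEdgeCluster ω t) ∂μ := by
    rw [← h10a]
    exact integral_neg _
  have hneg2 : ∫ ω in D, F (openEdgeCluster ω s) * (fun W => -Ψ W) (openEdgeCluster ω s) ∂μ =
      -∫ ω in D, F (openEdgeCluster ω s) * g (openEdgeCluster ω t) ∂μ := by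
    rw [← h10b, ← integral_neg]
    refine integral_congr_ae (Filter.Eventually.of_forall fun ω => ?_)
    simp only [mul_neg]
  rw [hneg1, hneg2] at key
  linarith [key]

/-! ### The deletion floor for the two-cluster repulsion of connection events -/

omit [Fintype V] in
/-- The pairs meeting `{s} ∪ V(W) ∪ {a}` form an increasing family in `W`. [folklore] -/
theorem barWith_mono (s a : V) :
    Monotone fun W : Set (Sym2 V) => {e : Sym2 V | ∃ v ∈ e, (v = s ∨ ∃ e' ∈ W, v ∈ e') ∨ v = a} := by
  rintro W W' h e ⟨v, hv, hvK⟩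
  refine ⟨v, hv, ?_⟩
  rcases hvK with (h1 | ⟨e', he', hve'⟩) | h3
  · exact Or.inl (Or.inl h1)
  · exact Or.inl (Or.inr ⟨e', h he', hve'⟩)
  · exact Or.inr h3

omit [Fintype V] in
/-- If `a ∈ {s} ∪ V(W)` then adding the pairs at `a` to `W̄` changes nothing. [folklore] -/
theorem barWith_eq_bar_of_mem {s a : V} {W : Set (Sym2 V)} (ha : a = s ∨ ∃ e' ∈ W, a ∈ e') :
    {e : Sym2 V | ∃ v ∈ e, (v = s ∨ ∃ e' ∈ W, v ∈ e') ∨ v = a} = {e | ∃ v ∈ e, v = s ∨ ∃ e' ∈ W, v ∈ e'} := by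
  ext e
  constructor
  · rintro ⟨v, hv, h | h⟩
    · exact ⟨v, hv, h⟩
    · exact ⟨v, hv, h ▸ ha⟩
  · rintro ⟨v, hv, h⟩
    exact ⟨v, hv, Or.inl h⟩

/-- **Deletion floor for the two-cluster repulsion (quantitative BHK Thm 1.4 / eq. (2)).**  `D = {s ↮ t}`, `s ≠ t`, vertices `a, o`.
With `P_W(t↔o) := μ{η : t ↔ o in η ∖ W̄}` the residual connection probability off the cluster `W` and `W̄_a := W̄ ∪ {pairs at a}`:
  `μ(D ∩ {s↔a}) · ∫_D ( P_{C_s}(t↔o) − P_{C_s,a}(t↔o) ) dμ ≤ μ(D ∩ {s↔a})·μ(D ∩ {t↔o}) − μ(D)·μ(D ∩ {s↔a} ∩ {t↔o})`,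
i.e. `−Cov(1{s↔a}, 1{t↔o} | s↮t) ≥ ν(s↔a) · E_ν[ drop of the residual t–o connection probability when a is deleted as well ]`
(the integrand vanishes when `a ∈ C_s`).  An explicit lower bound for van den Berg–Häggström–Kahn's conditional NEGATIVE correlation
of the two clusters (their Thm 1.4 / eq. (2) give the sign); BENCH row M2-R11 of the prim-rate lane (the «a-blocking» member of the
attachment-floor family).  Proof: `twoCluster_negCov_ge_majorant_gap` with `F = 1{a ∈ V(C_s)}`, `g = 1{o ∈ V(C_t)}` and the majorant
`G̃(W) = −Σ_η weight(η) g(C_t(η ∖ W̄_a))` (increasing by BHK's coupling, `BHK2006.condAvg_mono`).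
[cite: VandenbergHaggstromKahn2005, Thm. 1.4 and eq. (2) (pp. 2, 7)] -/
theorem twoCluster_repulsion_openConn_ge_deletion (w : Sym2 V → unitInterval) (s t a o : V) (hst : s ≠ t) :
    (prodBernoulli w).real ({ω : BondConfig V | ¬ (openGraph ω).Reachable s t} ∩ openConn s a) *
      (∫ ω in {ω : BondConfig V | ¬ (openGraph ω).Reachable s t},
        ((prodBernoulli w).real {η : BondConfig V |
            (openGraph (η \ {e | ∃ v ∈ e, v ∈ openCluster ω s})).Reachable t o} -
          (prodBernoulli w).real {η : BondConfig V |
            (openGraph (η \ {e | ∃ v ∈ e, v ∈ openCluster ω s ∨ v = a})).Reachable t o}) ∂(prodBernoulli w)) ≤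
    (prodBernoulli w).real ({ω : BondConfig V | ¬ (openGraph ω).Reachable s t} ∩ openConn s a) *
        (prodBernoulli w).real ({ω : BondConfig V | ¬ (openGraph ω).Reachable s t} ∩ openConn t o) -
      (prodBernoulli w).real {ω : BondConfig V | ¬ (openGraph ω).Reachable s t} *
        (prodBernoulli w).real ({ω : BondConfig V | ¬ (openGraph ω).Reachable s t} ∩ openConn s a ∩ openConn t o) := by
  set μ := prodBernoulli w with hμ
  set w' : Sym2 V → ℝ := fun e => (w e : ℝ) with hw'
  have hw0 : ∀ e, 0 ≤ w' e := fun e => (w e).2.1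
  have hw1 : ∀ e, w' e ≤ 1 := fun e => (w e).2.2
  set D : Set (BondConfig V) := {ω : BondConfig V | ¬ (openGraph ω).Reachable s t} with hD
  have hmeas : ∀ S : Set (BondConfig V), MeasurableSet S := fun _ => MeasurableSet.of_discrete
  -- vertex spans
  have hspan : ∀ (ζ : BondConfig V) (x y : V), (y = x ∨ ∃ e' ∈ openEdgeCluster ζ x, y ∈ e') ↔ y ∈ openCluster ζ x := by
    intro ζ x y
    rw [KNPreFKG.openCluster_eq_setOf_openEdgeCluster]; rfl
  -- the functionals
  set F : Set (Sym2 V) → ℝ := fun W => if (a = s ∨ ∃ e' ∈ W, a ∈ e') then 1 else 0 with hF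
  set g : Set (Sym2 V) → ℝ := fun K => if (o = t ∨ ∃ e' ∈ K, o ∈ e') then 1 else 0 with hg
  set B : Set (Sym2 V) → Set (Sym2 V) := fun W => {e | ∃ v ∈ e, v = s ∨ ∃ e' ∈ W, v ∈ e'} with hB
  set Ba : Set (Sym2 V) → Set (Sym2 V) := fun W => {e : Sym2 V | ∃ v ∈ e, (v = s ∨ ∃ e' ∈ W, v ∈ e') ∨ v = a} with hBa
  set Ψ : Set (Sym2 V) → ℝ := fun W => ∑ η, weight w' η * g (openEdgeCluster (η \ B W) t) with hΨ
  set Ψa : Set (Sym2 V) → ℝ := fun W => ∑ η, weight w' η * g (openEdgeCluster (η \ Ba W) t) with hΨa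
  have hspanmono : ∀ (x y : V), Monotone fun W : Set (Sym2 V) => (if (y = x ∨ ∃ e' ∈ W, y ∈ e') then (1 : ℝ) else 0) := by
    intro x y W W' h
    by_cases hy : (y = x ∨ ∃ e' ∈ W, y ∈ e')
    · have hy' : (y = x ∨ ∃ e' ∈ W', y ∈ e') := hy.imp id fun ⟨e', he', hye'⟩ => ⟨e', h he', hye'⟩
      simp only [if_pos hy, if_pos hy', le_refl]
    · simp only [if_neg hy]; split_ifs <;> norm_num
  have hFmono : Monotone F := hspanmono s a
  have hgmono : Monotone g := hspanmono t o
  -- the majorant `-Ψa` is increasing (BHK's coupling with the larger deleted set `W̄ ∪ {pairs at a}`)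
  have hGtmono : Monotone fun W => -Ψa W := by
    have h := condAvg_mono hw0 hw1 t (B := Ba) (barWith_mono s a) (H := fun _ K => -g K)
      (fun _ _ _ _ => le_rfl) (fun _ K K' hKK' => neg_le_neg (hgmono hKK'))
    intro W W' hWW'
    have h' := h hWW'
    simp only [hΨa, mul_neg, Finset.sum_neg_distrib] at h' ⊢
    exact h'
  have hFG : ∀ W, F W * (fun W => -Ψa W) W = F W * -Ψ W := by
    intro W
    by_cases ha : (a = s ∨ ∃ e' ∈ W, a ∈ e')
    · simp only [hΨa, hΨ, hBa, hB, barWith_eq_bar_of_mem ha]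
    · simp only [hF, if_neg ha, zero_mul]
  have key := twoCluster_negCov_ge_majorant_gap w s t hst F g (fun W => -Ψa W) hFmono hGtmono hFG
  rw [← hμ, ← hD] at key
  -- identification of the integrals with measures of events
  have hind : ∀ (A : Set (BondConfig V)), ∫ ω in D, (if ω ∈ A then (1 : ℝ) else 0) ∂μ = μ.real (D ∩ A) := by
    intro A
    have h1 : (fun ω : BondConfig V => if ω ∈ A then (1 : ℝ) else 0) = A.indicator fun _ => (1 : ℝ) := by
      funext ω; rw [Set.indicator_apply]
    rw [h1, integral_indicator (hmeas A), Measure.restrict_restrict (hmeas A), integral_const, smul_eq_mul, mul_one,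
      Set.inter_comm, measureReal_restrict_apply_univ]
  have hIF : ∫ ω in D, F (openEdgeCluster ω s) ∂μ = μ.real (D ∩ openConn s a) := by
    rw [← hind]
    refine setIntegral_congr_fun (hmeas D) fun ω _ => ?_
    simp only [hF, hspan ω s a]
    by_cases h : a ∈ openCluster ω s
    · rw [if_pos h, if_pos (show ω ∈ openConn s a from h)]
    · rw [if_neg h, if_neg (show ω ∉ openConn s a from h)]
  have hIg : ∫ ω in D, g (openEdgeCluster ω t) ∂μ = μ.real (D ∩ openConn t o) := by
    rw [← hind]
    refine setIntegral_congr_fun (hmeas D) fun ω _ => ?_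
    simp only [hg, hspan ω t o]
    by_cases h : o ∈ openCluster ω t
    · rw [if_pos h, if_pos (show ω ∈ openConn t o from h)]
    · rw [if_neg h, if_neg (show ω ∉ openConn t o from h)]
  have hIFg : ∫ ω in D, F (openEdgeCluster ω s) * g (openEdgeCluster ω t) ∂μ = μ.real (D ∩ openConn s a ∩ openConn t o) := by
    rw [Set.inter_assoc, ← hind]
    refine setIntegral_congr_fun (hmeas D) fun ω _ => ?_
    simp only [hF, hg, hspan ω s a, hspan ω t o]
    by_cases h1 : a ∈ openCluster ω s
    · by_cases h2 : o ∈ openCluster ω t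
      · rw [if_pos h1, if_pos h2, one_mul, if_pos (show ω ∈ openConn s a ∩ openConn t o from ⟨h1, h2⟩)]
      · rw [if_pos h1, if_neg h2, one_mul, if_neg (show ω ∉ openConn s a ∩ openConn t o from fun h => h2 h.2)]
    · rw [if_neg h1, zero_mul, if_neg (show ω ∉ openConn s a ∩ openConn t o from fun h => h1 h.1)]
  -- the residual connection probabilities
  have hres : ∀ (W : Set (Sym2 V)) (Bset : Set (Sym2 V)),
      ∑ η, weight w' η * g (openEdgeCluster (η \ Bset) t) = μ.real {η : BondConfig V | (openGraph (η \ Bset)).Reachable t o} := by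
    intro W Bset
    rw [← integral_indicator_one (hmeas _), integral_prodBernoulli_eq_sum]
    refine Finset.sum_congr rfl fun η _ => ?_
    congr 1
    simp only [hg, hspan (η \ Bset) t o, Set.indicator_apply, Set.mem_setOf_eq, Pi.one_apply]
    rfl
  have hBC : ∀ ω : BondConfig V, B (openEdgeCluster ω s) = {e | ∃ v ∈ e, v ∈ openCluster ω s} := by
    intro ω; ext e
    simp only [hB, Set.mem_setOf_eq, hspan ω s]
  have hBaC : ∀ ω : BondConfig V, Ba (openEdgeCluster ω s) = {e | ∃ v ∈ e, v ∈ openCluster ω s ∨ v = a} := by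
    intro ω; ext e
    simp only [hBa, Set.mem_setOf_eq, hspan ω s]
  have hIGt : ∫ ω in D, -Ψa (openEdgeCluster ω s) ∂μ + ∫ ω in D, g (openEdgeCluster ω t) ∂μ =
      ∫ ω in D, (μ.real {η : BondConfig V | (openGraph (η \ {e | ∃ v ∈ e, v ∈ openCluster ω s})).Reachable t o} -
        μ.real {η : BondConfig V | (openGraph (η \ {e | ∃ v ∈ e, v ∈ openCluster ω s ∨ v = a})).Reachable t o}) ∂μ := by
    have h10a : ∫ ω in D, g (openEdgeCluster ω t) ∂μ = ∫ ω in D, Ψ (openEdgeCluster ω s) ∂μ := by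
      have hm : ∑ ω, weight w' ω = 1 := by
        have h1 := integral_prodBernoulli_eq_sum w fun _ => (1 : ℝ)
        simp only [integral_const, probReal_univ, smul_eq_mul, mul_one] at h1
        exact h1.symm
      rw [setIntegral_eq_sum_weight, setIntegral_eq_sum_weight]
      exact sum_cond_cluster w' hm s t (fun _ K => g K) fun ω => Iff.rfl
    rw [h10a, ← integral_add (Integrable.of_finite) (Integrable.of_finite)]
    refine setIntegral_congr_fun (hmeas D) fun ω _ => ?_
    simp only [hΨ, hΨa, hres (openEdgeCluster ω s), hBC ω, hBaC ω]
    ring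
  rw [hIGt] at key
  rw [hIF, hIg, hIFg] at key
  exact key

end QuantBHK

end Summit.CriticalPhenomena.PercolationContinuityZ3.Theorems
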